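import Mathlib.Tactic.Ring
import Mathlib.Tactic.Linarith
import Mathlib.Tactic.Positivity
import Mathlib.Tactic.FieldSimp
import Mathlib.Tactic.LinearCombination
import Mathlib.Algebra.Order.BigOperators.Ring.Finset
import Mathlib.Algebra.BigOperators.Field
import Mathlib.Algebra.QuadraticDiscriminant
import Mathlib.Data.Fintype.Basic
import Mathlib.Data.Real.Basic
import Literature.AlgebraicGeometry.HodgeTheory.WeilClassTestChargeZeroLemmaAssembly
import HarnessLib

/-!
# The charge-zero lemma, STEP 3 (hyperplane form of Theorem 1), kernel-checked for any finite family of atoms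

Prover 2, generation 15 of the hodge-weil ladder cell (note `run/shared/lean/b2b/hodge-weil/b2b-hweil-pv2-g15/DIVIDED-DIFFERENCE-G15.md`,
§3). pv2-g8's Lemma N₂′ (`b2b-hweil-pv2-g8/CHARGE-ZERO-LEMMA.md` §4: centring + (P1) + (P3) + N-dominance ⟹ `Q₂ ≥ 0`) rests on
THEOREM 1 (`key_inequality_unconditional`, `Literature/…/WeilClassTestChargeZeroLemmaAssembly.lean`, kernel) and on three finite-sum steps,
of which Steps 1–2 are `linear_combination` identities (`…StepOne.lean`, format (6,4)) and STEP 3 — 'the quadratic form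
`Ψ(h) = Σ_k C_kh_k² + (Σ_k h_k)²` is positive semidefinite on the hyperplane `Σ_k (T − x_k)h_k = 0`' — was left as dictionary (a bordered
determinant). THIS FILE proves Step 3 for an arbitrary finite index type, in the following unnormalised form (`core_form_nonneg`): for weights
`p_k > 0`, positions `|x_k| ≤ p_k`, `T = Σp`, `M = Σx_kp_k`, `V_k = T² + M − 3Tx_k` and every `g` with `Σ_k p_k(T − x_k)g_k = 0`,
`0 ≤ Σ_k p_kV_kg_k² + T·(Σ_k p_kg_k)²`.
Proof (no determinants). If no `V_k` is negative, termwise. Otherwise `V_i < 0` for exactly one `i` and Theorem 1 gives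
`Ω := −Σ_k p_k/V_k ≥ 4T/(5T² − M) > 0` (`sum_p_div_V_bound`). (1) `B(r) := Σ p_kV_kr_k² ≥ 0` whenever `Σ p_kr_k = 0`
(`B_nonneg_of_sum_zero`: eliminate `r_i`, weighted Cauchy–Schwarz over the other atoms, sign of `Σ p/V`). (2) Cauchy–Schwarz for the form `B`
on that hyperplane against the test vector `g₀_k = T/V_k + Ω` (`Σ p g₀ = 0`, `B(r, g₀) = Ω·Σ p_kV_kr_k`, `B(g₀) = TΩ(T + Ω(T² − 2M))`), via the
discriminant of `t ↦ B(r − t g₀) ≥ 0`. (3) Split `g = ḡ + r` (`ḡ` the `p`-mean); the hypothesis reads `Σ p_kV_kr_k = −3Tḡ(T² − M)`, the target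
`B(r) − 4Tḡ²(T² − M) ≥ 0`, and (2) + `Ω(5T² − M) ≥ 4T` close it. Together with the per-format Step 1–2 identities this makes Lemma N₂′
kernel-complete (format (5,3): `WeilClassTestFormatFiveThreeQ2.lean`). Pure algebra over a `Fintype`; nothing here is a case of HC, a rung or a
door edge; no statement of Markman's papers is used. New cell result ⇒ Summits/.
-/

set_option linter.dupNamespace false

open Finset
open Literature.AlgebraicGeometry.HodgeTheory.WeilClassTestChargeZeroLemma

namespace Summit.HodgeConjecture.HodgeConjecture.WeilClassTestChargeZeroHyperplane

/-- From Theorem 1 (`key_inequality_unconditional`): if some `V_i < 0` then `(5T² − M)·Σ_k p_k/V_k ≤ −4T`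
(using `3T·a_k = (5T² − M)p_k + p_kV_k`). -/
theorem sum_p_div_V_bound {ι : Type*} [Fintype ι] [DecidableEq ι]
    (p x : ι → ℝ) (hp : ∀ k, 0 < p k) (hx : ∀ k, |x k| ≤ p k)
    (T M : ℝ) (hT : T = ∑ k, p k) (hM : M = ∑ k, x k * p k)
    (V : ι → ℝ) (hV : ∀ k, V k = T ^ 2 + M - 3 * T * x k)
    (i : ι) (hVi : V i < 0) :
    (5 * T ^ 2 - M) * ∑ k, p k / V k ≤ -4 * T := by
  set a : ι → ℝ := fun k => p k * (2 * T - x k) with ha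
  have hkey := key_inequality_unconditional p x hp hx T M hT hM V a hV (fun k => rfl) i hVi
  have hVne : ∀ k, V k ≠ 0 := by
    intro k
    by_cases hk : k = i
    · rw [hk]; exact ne_of_lt hVi
    · exact ne_of_gt (V_pos_of_exceptional at_most_one_exceptional_le p x hp hx T M hT hM V hV i hVi k hk)
  have hTpos : 0 < T := by
    rw [hT]; exact lt_of_lt_of_le (hp i) (Finset.single_le_sum (fun k _ => (hp k).le) (Finset.mem_univ i))
  have hterm : ∀ k, 3 * T * (a k / V k) = (5 * T ^ 2 - M) * (p k / V k) + p k := by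
    intro k
    have e : 3 * T * a k = (5 * T ^ 2 - M) * p k + p k * V k := by simp only [ha, hV k]; ring
    have hinv : V k * (V k)⁻¹ = 1 := mul_inv_cancel₀ (hVne k)
    calc 3 * T * (a k / V k) = (3 * T * a k) * (V k)⁻¹ := by rw [div_eq_mul_inv]; ring
      _ = ((5 * T ^ 2 - M) * p k + p k * V k) * (V k)⁻¹ := by rw [e]
      _ = (5 * T ^ 2 - M) * (p k / V k) + p k * (V k * (V k)⁻¹) := by rw [div_eq_mul_inv]; ring
      _ = (5 * T ^ 2 - M) * (p k / V k) + p k := by rw [hinv, mul_one]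
  have hsum : 3 * T * ∑ k, a k / V k = (5 * T ^ 2 - M) * ∑ k, p k / V k + T := by
    rw [Finset.mul_sum, Finset.mul_sum, hT]
    conv_rhs => rw [← Finset.sum_add_distrib]
    apply Finset.sum_congr rfl
    intro k _
    rw [← hT]; exact hterm k
  have h3 : 3 * T * (1 + ∑ k, a k / V k) ≤ 0 :=
    mul_nonpos_of_nonneg_of_nonpos (by linarith) hkey
  linarith [h3, hsum]

/-- STEP (1): `B(r) = Σ_k p_kV_kr_k² ≥ 0` for every `r` with `Σ_k p_kr_k = 0`, provided some `V_i < 0` (then all other `V_k > 0` and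
`Σ p/V < 0`): eliminate `r_i`, weighted Cauchy–Schwarz on the rest. -/
theorem B_nonneg_of_sum_zero {ι : Type*} [Fintype ι] [DecidableEq ι]
    (p x : ι → ℝ) (hp : ∀ k, 0 < p k) (hx : ∀ k, |x k| ≤ p k)
    (T M : ℝ) (hT : T = ∑ k, p k) (hM : M = ∑ k, x k * p k)
    (V : ι → ℝ) (hV : ∀ k, V k = T ^ 2 + M - 3 * T * x k)
    (i : ι) (hVi : V i < 0)
    (r : ι → ℝ) (hr : ∑ k, p k * r k = 0) :
    0 ≤ ∑ k, p k * V k * r k ^ 2 := by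
  have hVpos : ∀ k, k ≠ i → 0 < V k :=
    fun k hk => V_pos_of_exceptional at_most_one_exceptional_le p x hp hx T M hT hM V hV i hVi k hk
  have hTpos : 0 < T := by
    rw [hT]; exact lt_of_lt_of_le (hp i) (Finset.single_le_sum (fun k _ => (hp k).le) (Finset.mem_univ i))
  -- M ≤ T², so 5T² − M > 0
  have hMle : M ≤ T ^ 2 := by
    have h1 : ∑ k, x k * p k ≤ ∑ k, p k ^ 2 := by
      apply Finset.sum_le_sum; intro k _
      have := (abs_le.mp (hx k)).2; nlinarith [hp k]
    have h2 := sum_sq_le_sq_sum (Finset.univ : Finset ι) p (fun k => (hp k).le)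
    rw [hM, hT]; linarith
  have hbound := sum_p_div_V_bound p x hp hx T M hT hM V hV i hVi
  have hSneg : ∑ k, p k / V k < 0 := by
    by_contra hc
    push Not at hc
    have : 0 ≤ (5 * T ^ 2 - M) * ∑ k, p k / V k := mul_nonneg (by nlinarith) hc
    linarith
  set R : Finset ι := Finset.univ.erase i with hR
  have hsplit : ∀ g : ι → ℝ, ∑ k, g k = g i + ∑ k ∈ R, g k := by
    intro g; rw [hR, ← Finset.add_sum_erase _ _ (Finset.mem_univ i)]
  have hRi : ∀ k ∈ R, k ≠ i := fun k hk => (Finset.mem_erase.mp hk).1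
  set S' := ∑ k ∈ R, p k / V k with hS'
  set D := ∑ k ∈ R, p k * V k * r k ^ 2 with hD
  set w := ∑ k ∈ R, p k * r k with hw
  have hDnn : 0 ≤ D := Finset.sum_nonneg (fun k hk => by
    have := hp k; have := hVpos k (hRi k hk); positivity)
  -- weighted Cauchy–Schwarz over R: w² ≤ S'·D
  have hcs : w ^ 2 ≤ S' * D := by
    rw [hw, hS', hD, sq, Finset.sum_mul_sum, Finset.sum_mul_sum]
    have h2 : ∑ k ∈ R, ∑ l ∈ R, 2 * (p k * r k) * (p l * r l)
        ≤ ∑ k ∈ R, ∑ l ∈ R, (p k / V k * (p l * V l * r l ^ 2) + p l / V l * (p k * V k * r k ^ 2)) := by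
      apply Finset.sum_le_sum; intro k hk; apply Finset.sum_le_sum; intro l hl
      exact pair_cs (p k) (p l) (V k) (V l) (r k) (r l) (hVpos k (hRi k hk)) (hVpos l (hRi l hl))
        (hp k).le (hp l).le
    have h3 : ∑ k ∈ R, ∑ l ∈ R, (p k / V k * (p l * V l * r l ^ 2) + p l / V l * (p k * V k * r k ^ 2))
        = 2 * ∑ k ∈ R, ∑ l ∈ R, p k / V k * (p l * V l * r l ^ 2) := by
      have hc : ∑ k ∈ R, ∑ l ∈ R, p l / V l * (p k * V k * r k ^ 2)
          = ∑ k ∈ R, ∑ l ∈ R, p k / V k * (p l * V l * r l ^ 2) := Finset.sum_comm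
      simp only [Finset.sum_add_distrib]
      rw [hc]; ring
    have h4 : ∑ k ∈ R, ∑ l ∈ R, 2 * (p k * r k) * (p l * r l) = 2 * ∑ k ∈ R, ∑ l ∈ R, p k * r k * (p l * r l) := by
      rw [Finset.mul_sum]; apply Finset.sum_congr rfl; intro k _
      rw [Finset.mul_sum]; apply Finset.sum_congr rfl; intro l _; ring
    linarith [h2, h3, h4]
  -- eliminate r_i: p_i r_i = -w
  have hri : p i * r i = -w := by
    have := hr; rw [hsplit (fun k => p k * r k)] at this; linarith
  -- total S = p_i/V_i + S' < 0
  have hStot : ∑ k, p k / V k = p i / V i + S' := hsplit (fun k => p k / V k)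
  rw [hsplit (fun k => p k * V k * r k ^ 2)]
  show 0 ≤ p i * V i * r i ^ 2 + D
  -- p_i V_i r_i² = (V_i/p_i) w²  ≥ (V_i/p_i) S' D, and 1 + (V_i/p_i) S' = (V_i/p_i)(p_i/V_i + S') ≥ 0
  have hpi := hp i
  have hViS : 0 ≤ V i * (p i / V i + S') := by
    have : p i / V i + S' < 0 := by rw [← hStot]; exact hSneg
    nlinarith
  have e1 : p i * V i * r i ^ 2 * p i = V i * w ^ 2 := by
    have : (p i * r i) ^ 2 = w ^ 2 := by rw [hri]; ring
    nlinarith [this]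
  -- multiply the goal by p_i > 0
  have key : 0 ≤ (p i * V i * r i ^ 2 + D) * p i := by
    have e2 : (p i * V i * r i ^ 2 + D) * p i = V i * w ^ 2 + D * p i := by rw [add_mul, e1]
    rw [e2]
    -- V_i w² ≥ V_i S' D (as V_i < 0 and w² ≤ S' D), and V_i S' D + D p_i = D · (V_i (p_i/V_i + S')) ≥ 0
    have h5 : V i * (S' * D) ≤ V i * w ^ 2 := mul_le_mul_of_nonpos_left hcs hVi.le
    have e3 : V i * (p i / V i + S') = p i + V i * S' := by
      field_simp [ne_of_lt hVi]
    have h6 : 0 ≤ D * (p i + V i * S') := by rw [← e3]; exact mul_nonneg hDnn hViS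
    nlinarith [h5, h6]
  exact (mul_nonneg_iff_of_pos_right hpi).mp key

/-- The closing arithmetic of Step 3: from `Ω(5T² − M) ≥ 4T`, `M ≤ T²`, `B(r) ≥ 0`, `c = −3Tḡ(T² − M)`, `Δ' ≥ 0` and the
Cauchy–Schwarz consequence `Ωc² ≤ TΔ'·B(r)` (with `Δ' = T + Ω(T² − 2M)`), conclude `B(r) ≥ 4Tḡ²(T² − M)`. -/
theorem step3_arith (T M Ω Br gbar c : ℝ) (hT : 0 < T) (hΩ : 0 < Ω) (hbound : 4 * T ≤ Ω * (5 * T ^ 2 - M))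
    (hM : M ≤ T ^ 2) (hBr : 0 ≤ Br) (hc : c = -3 * T * gbar * (T ^ 2 - M))
    (hΔ : 0 ≤ T + Ω * (T ^ 2 - 2 * M)) (hcs : Ω * c ^ 2 ≤ T * (T + Ω * (T ^ 2 - 2 * M)) * Br) :
    0 ≤ Br - 4 * T * gbar ^ 2 * (T ^ 2 - M) := by
  have hc2 : c ^ 2 = 9 * T ^ 2 * gbar ^ 2 * (T ^ 2 - M) ^ 2 := by rw [hc]; ring
  rcases eq_or_lt_of_le hΔ with hΔ0 | hΔpos
  · -- Δ' = 0 ⇒ Ω c² ≤ 0 ⇒ c = 0 ⇒ ḡ (T² − M) = 0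
    have hc0 : c ^ 2 = 0 := by
      have h := hcs
      rw [← hΔ0, mul_zero, zero_mul] at h
      have h' : Ω * c ^ 2 ≤ Ω * 0 := by rw [mul_zero]; exact h
      have := le_of_mul_le_mul_left h' hΩ
      exact le_antisymm this (sq_nonneg c)
    have hz : gbar ^ 2 * (T ^ 2 - M) ^ 2 = 0 := by
      rw [hc0] at hc2
      have h9 : (0:ℝ) < 9 * T ^ 2 := by positivity
      have : 9 * T ^ 2 * (gbar ^ 2 * (T ^ 2 - M) ^ 2) = 0 := by linarith
      rcases mul_eq_zero.mp this with h3 | h3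
      · exfalso; linarith
      · exact h3
    have hz' : gbar * (T ^ 2 - M) = 0 := by
      have : (gbar * (T ^ 2 - M)) ^ 2 = 0 := by rw [mul_pow]; exact hz
      exact pow_eq_zero_iff (n := 2) (by norm_num) |>.mp this
    have e : 4 * T * gbar ^ 2 * (T ^ 2 - M) = 4 * T * gbar * (gbar * (T ^ 2 - M)) := by ring
    rw [e, hz', mul_zero, sub_zero]
    exact hBr
  · have hG : 0 ≤ 9 * Ω * (T ^ 2 - M) - 4 * (T + Ω * (T ^ 2 - 2 * M)) := by
      have e : 9 * Ω * (T ^ 2 - M) - 4 * (T + Ω * (T ^ 2 - 2 * M)) = Ω * (5 * T ^ 2 - M) - 4 * T := by ring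
      rw [e]; linarith
    have hTM : 0 ≤ T ^ 2 - M := by linarith
    have h1 : 0 ≤ T * (T + Ω * (T ^ 2 - 2 * M)) * Br - Ω * (9 * T ^ 2 * gbar ^ 2 * (T ^ 2 - M) ^ 2) := by
      rw [hc2] at hcs; linarith
    have h2 : 0 ≤ T ^ 2 * gbar ^ 2 * (T ^ 2 - M) * (9 * Ω * (T ^ 2 - M) - 4 * (T + Ω * (T ^ 2 - 2 * M))) :=
      mul_nonneg (by positivity) hG
    have e : (T * (T + Ω * (T ^ 2 - 2 * M))) * (Br - 4 * T * gbar ^ 2 * (T ^ 2 - M))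
        = (T * (T + Ω * (T ^ 2 - 2 * M)) * Br - Ω * (9 * T ^ 2 * gbar ^ 2 * (T ^ 2 - M) ^ 2))
          + T ^ 2 * gbar ^ 2 * (T ^ 2 - M) * (9 * Ω * (T ^ 2 - M) - 4 * (T + Ω * (T ^ 2 - 2 * M))) := by ring
    have h3 : 0 ≤ (T * (T + Ω * (T ^ 2 - 2 * M))) * (Br - 4 * T * gbar ^ 2 * (T ^ 2 - M)) := by
      rw [e]; exact add_nonneg h1 h2
    exact (mul_nonneg_iff_of_pos_left (mul_pos hT hΔpos)).mp h3

set_option maxHeartbeats 400000 in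
/-- **STEP 3 of Lemma N₂′ (hyperplane form of Theorem 1), any finite family of atoms.** For weights `p_k > 0`, positions `|x_k| ≤ p_k`,
`T = Σp`, `M = Σx_kp_k`, `V_k = T² + M − 3Tx_k`, and every `g` with `Σ_k p_k(T − x_k)g_k = 0`:
`0 ≤ Σ_k p_kV_kg_k² + T·(Σ_k p_kg_k)²`. (In `CHARGE-ZERO-LEMMA.md` §4 this is `Ψ|_{q^⊥} ⪰ 0`, there derived from a bordered determinant;
here: Theorem 1 ⟹ `Ω = −Σp/V ≥ 4T/(5T² − M)`, Step (1), and Cauchy–Schwarz for `B` on the hyperplane against `g₀ = T/V + Ω`.) -/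
theorem core_form_nonneg {ι : Type*} [Fintype ι] [DecidableEq ι]
    (p x : ι → ℝ) (hp : ∀ k, 0 < p k) (hx : ∀ k, |x k| ≤ p k)
    (T M : ℝ) (hT : T = ∑ k, p k) (hM : M = ∑ k, x k * p k)
    (V : ι → ℝ) (hV : ∀ k, V k = T ^ 2 + M - 3 * T * x k)
    (g : ι → ℝ) (hg : ∑ k, p k * (T - x k) * g k = 0) :
    0 ≤ ∑ k, p k * V k * g k ^ 2 + T * (∑ k, p k * g k) ^ 2 := by
  have hTnn : 0 ≤ T := by rw [hT]; exact Finset.sum_nonneg (fun k _ => (hp k).le)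
  by_cases hex : ∃ i, V i < 0
  swap
  · push Not at hex
    apply add_nonneg _ (mul_nonneg hTnn (sq_nonneg _))
    apply Finset.sum_nonneg; intro k _
    have := hex k; have := hp k; positivity
  obtain ⟨i, hVi⟩ := hex
  have hVpos : ∀ k, k ≠ i → 0 < V k :=
    fun k hk => V_pos_of_exceptional at_most_one_exceptional_le p x hp hx T M hT hM V hV i hVi k hk
  have hVne : ∀ k, V k ≠ 0 := by
    intro k; by_cases hk : k = i
    · rw [hk]; exact ne_of_lt hVi
    · exact ne_of_gt (hVpos k hk)
  have hTpos : 0 < T := by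
    rw [hT]; exact lt_of_lt_of_le (hp i) (Finset.single_le_sum (fun k _ => (hp k).le) (Finset.mem_univ i))
  have hMle : M ≤ T ^ 2 := by
    have h1 : ∑ k, x k * p k ≤ ∑ k, p k ^ 2 := by
      apply Finset.sum_le_sum; intro k _
      have := (abs_le.mp (hx k)).2; nlinarith [hp k]
    have h2 := sum_sq_le_sq_sum (Finset.univ : Finset ι) p (fun k => (hp k).le)
    rw [hM, hT]; linarith
  -- Ω := -Σ p/V and the Theorem-1 bound Ω(5T² − M) ≥ 4T
  set Ω : ℝ := -∑ k, p k / V k with hΩ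
  have hbound : 4 * T ≤ Ω * (5 * T ^ 2 - M) := by
    have := sum_p_div_V_bound p x hp hx T M hT hM V hV i hVi
    rw [hΩ]; linarith
  have hΩpos : 0 < Ω := by
    by_contra hc; push Not at hc
    have : Ω * (5 * T ^ 2 - M) ≤ 0 := mul_nonpos_of_nonpos_of_nonneg hc (by nlinarith)
    linarith
  -- some finite sums
  have hsumV : ∑ k, p k * V k = T * (T ^ 2 - 2 * M) := by
    have : ∀ k, p k * V k = (T ^ 2 + M) * p k - 3 * T * (x k * p k) := by intro k; rw [hV k]; ring
    simp_rw [this]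
    rw [Finset.sum_sub_distrib, ← Finset.mul_sum, ← Finset.mul_sum, ← hT, ← hM]; ring
  have hsumxV : ∀ f : ι → ℝ, ∑ k, p k * x k * f k = ((T ^ 2 + M) * ∑ k, p k * f k - ∑ k, p k * V k * f k) / (3 * T) := by
    intro f
    have h3T : (3 * T) ≠ 0 := by positivity
    rw [eq_div_iff h3T, Finset.mul_sum, Finset.sum_mul, ← Finset.sum_sub_distrib]
    apply Finset.sum_congr rfl; intro k _; rw [hV k]; ring
  -- split g = ḡ + r
  set gbar : ℝ := (∑ k, p k * g k) / T with hgbar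
  set r : ι → ℝ := fun k => g k - gbar with hrdef
  have hr : ∑ k, p k * r k = 0 := by
    simp only [hrdef, mul_sub, Finset.sum_sub_distrib, ← Finset.sum_mul, ← hT]
    rw [hgbar]; field_simp; ring
  set c : ℝ := ∑ k, p k * V k * r k with hc
  set Br : ℝ := ∑ k, p k * V k * r k ^ 2 with hBr
  have hBr_nn : 0 ≤ Br := B_nonneg_of_sum_zero p x hp hx T M hT hM V hV i hVi r hr
  -- the hypothesis in terms of c and ḡ:  c = -3T ḡ (T² − M)
  have hc_eq : c = -3 * T * gbar * (T ^ 2 - M) := by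
    have h1 : ∑ k, p k * (T - x k) * g k = T * ∑ k, p k * g k - ∑ k, p k * x k * g k := by
      rw [Finset.mul_sum, ← Finset.sum_sub_distrib]; apply Finset.sum_congr rfl; intro k _; ring
    have h2 := hsumxV g
    have hpg : ∑ k, p k * g k = T * gbar := by rw [hgbar]; field_simp
    -- Σ pV g = Σ pV r + ḡ Σ pV
    have h3 : ∑ k, p k * V k * g k = c + gbar * ∑ k, p k * V k := by
      rw [hc, Finset.mul_sum, ← Finset.sum_add_distrib]; apply Finset.sum_congr rfl; intro k _
      simp only [hrdef]; ring
    rw [h1, h2, hpg, h3, hsumV] at hg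
    have h3T : (3 * T) ≠ 0 := by positivity
    field_simp at hg
    nlinarith [hg, hTpos]
  -- the target in terms of Br, c, ḡ
  have htarget : ∑ k, p k * V k * g k ^ 2 + T * (∑ k, p k * g k) ^ 2 = Br - 4 * T * gbar ^ 2 * (T ^ 2 - M) := by
    have hpg : ∑ k, p k * g k = T * gbar := by rw [hgbar]; field_simp
    have h1 : ∑ k, p k * V k * g k ^ 2 = Br + 2 * gbar * c + gbar ^ 2 * ∑ k, p k * V k := by
      rw [hBr, hc, Finset.mul_sum, Finset.mul_sum, ← Finset.sum_add_distrib, ← Finset.sum_add_distrib]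
      apply Finset.sum_congr rfl; intro k _; simp only [hrdef]; ring
    rw [h1, hpg, hsumV, hc_eq]; ring
  rw [htarget]
  -- STEP (2): Cauchy–Schwarz for B on the hyperplane against g₀ = T/V + Ω
  set g₀ : ι → ℝ := fun k => T / V k + Ω with hg₀
  have hg₀sum : ∑ k, p k * g₀ k = 0 := by
    simp only [hg₀, mul_add, Finset.sum_add_distrib, ← Finset.sum_mul, ← hT]
    have : ∑ k, p k * (T / V k) = T * ∑ k, p k / V k := by
      rw [Finset.mul_sum]; apply Finset.sum_congr rfl; intro k _; ring
    rw [this, hΩ]; ring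
  have hBg₀ : ∑ k, p k * V k * g₀ k ^ 2 = T * Ω * (T + Ω * (T ^ 2 - 2 * M)) := by
    have hterm : ∀ k, p k * V k * g₀ k ^ 2 = T ^ 2 * (p k / V k) + 2 * T * Ω * p k + Ω ^ 2 * (p k * V k) := by
      intro k; simp only [hg₀]
      have hinv : V k * (V k)⁻¹ = 1 := mul_inv_cancel₀ (hVne k)
      calc p k * V k * (T / V k + Ω) ^ 2
          = T ^ 2 * (p k * (V k)⁻¹) * (V k * (V k)⁻¹) + 2 * T * Ω * p k * (V k * (V k)⁻¹) + Ω ^ 2 * (p k * V k) := by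
            rw [div_eq_mul_inv]; ring
        _ = T ^ 2 * (p k / V k) + 2 * T * Ω * p k + Ω ^ 2 * (p k * V k) := by rw [hinv, div_eq_mul_inv]; ring
    simp_rw [hterm]
    rw [Finset.sum_add_distrib, Finset.sum_add_distrib, ← Finset.mul_sum, ← Finset.mul_sum, ← Finset.mul_sum,
      ← hT, hsumV, hΩ]; ring
  have hBrg₀ : ∑ k, p k * V k * r k * g₀ k = Ω * c := by
    have hterm : ∀ k, p k * V k * r k * g₀ k = T * (p k * r k) + Ω * (p k * V k * r k) := by
      intro k; simp only [hg₀]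
      have hinv : V k * (V k)⁻¹ = 1 := mul_inv_cancel₀ (hVne k)
      calc p k * V k * r k * (T / V k + Ω) = T * (p k * r k) * (V k * (V k)⁻¹) + Ω * (p k * V k * r k) := by
            rw [div_eq_mul_inv]; ring
        _ = T * (p k * r k) + Ω * (p k * V k * r k) := by rw [hinv, mul_one]
    simp_rw [hterm]
    rw [Finset.sum_add_distrib, ← Finset.mul_sum, ← Finset.mul_sum, hr, hc]; ring
  -- t ↦ B(r − t g₀) ≥ 0 for all t
  have hquad : ∀ t : ℝ, 0 ≤ (T * Ω * (T + Ω * (T ^ 2 - 2 * M))) * (t * t) + (-2 * (Ω * c)) * t + Br := by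
    intro t
    have hmz : ∑ k, p k * (r k - t * g₀ k) = 0 := by
      simp only [mul_sub, Finset.sum_sub_distrib, hr]
      have : ∑ k, p k * (t * g₀ k) = t * ∑ k, p k * g₀ k := by
        rw [Finset.mul_sum]; apply Finset.sum_congr rfl; intro k _; ring
      rw [this, hg₀sum]; ring
    have hB := B_nonneg_of_sum_zero p x hp hx T M hT hM V hV i hVi (fun k => r k - t * g₀ k) hmz
    have hexp : ∑ k, p k * V k * (r k - t * g₀ k) ^ 2
        = Br - 2 * t * ∑ k, p k * V k * r k * g₀ k + t ^ 2 * ∑ k, p k * V k * g₀ k ^ 2 := by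
      rw [hBr, Finset.mul_sum, Finset.mul_sum, ← Finset.sum_sub_distrib, ← Finset.sum_add_distrib]
      apply Finset.sum_congr rfl; intro k _; ring
    rw [hexp, hBrg₀, hBg₀] at hB
    nlinarith [hB]
  have hdisc := discrim_le_zero hquad
  rw [discrim] at hdisc
  -- (2Ωc)² ≤ 4 · TΩΔ' · Br  ⇒  Ω c² ≤ T Δ' Br
  have hΔnn : 0 ≤ T + Ω * (T ^ 2 - 2 * M) := by
    -- B(g₀) ≥ 0 and T, Ω > 0
    have hB0 := B_nonneg_of_sum_zero p x hp hx T M hT hM V hV i hVi g₀ hg₀sum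
    rw [hBg₀] at hB0
    have : 0 < T * Ω := mul_pos hTpos hΩpos
    nlinarith
  have hcs : Ω * c ^ 2 ≤ T * (T + Ω * (T ^ 2 - 2 * M)) * Br := by nlinarith [hdisc, hΩpos]
  -- STEP (3): conclude.  9Ω(T² − M) − 4Δ' = Ω(5T² − M) − 4T ≥ 0.
  exact step3_arith T M Ω Br gbar c hTpos hΩpos hbound hMle hBr_nn hc_eq hΔnn hcs


/-- `core_form_nonneg` with NONNEGATIVE weights: atoms with `p_k = 0` (hence `x_k = 0`) contribute nothing, so the statement for
`p_k ≥ 0` follows from the one for the live atoms `{k | p_k > 0}` (a sub-`Fintype`). This is the form used by the per-format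
assemblies, where the F-root of maximal position is always a dead atom. -/
theorem core_form_nonneg_of_nonneg {ι : Type*} [Fintype ι] [DecidableEq ι]
    (p x : ι → ℝ) (hp : ∀ k, 0 ≤ p k) (hx : ∀ k, |x k| ≤ p k)
    (T M : ℝ) (hT : T = ∑ k, p k) (hM : M = ∑ k, x k * p k)
    (V : ι → ℝ) (hV : ∀ k, V k = T ^ 2 + M - 3 * T * x k)
    (g : ι → ℝ) (hg : ∑ k, p k * (T - x k) * g k = 0) :
    0 ≤ ∑ k, p k * V k * g k ^ 2 + T * (∑ k, p k * g k) ^ 2 := by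
  set S : Finset ι := Finset.univ.filter (fun k => 0 < p k) with hS
  -- sums of the form Σ p_k φ_k live on S
  have hvan : ∀ φ : ι → ℝ, ∑ k, p k * φ k = ∑ k ∈ S, p k * φ k := by
    intro φ
    rw [hS, Finset.sum_filter_of_ne]
    intro k _ hne
    rcases (hp k).lt_or_eq with h | h
    · exact h
    · exfalso; apply hne; rw [← h]; ring
  have hcoe : ∀ φ : ι → ℝ, ∑ k ∈ S, p k * φ k = ∑ k : S, p k * φ k :=
    fun φ => (Finset.sum_coe_sort S (fun k => p k * φ k)).symm
  -- the live family
  have hp' : ∀ k : S, 0 < p k := fun k => (Finset.mem_filter.mp k.2).2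
  have hx' : ∀ k : S, |x k| ≤ p k := fun k => hx k
  have hT' : T = ∑ k : S, p k := by
    rw [hT]
    have := hvan (fun _ => 1)
    simp only [mul_one] at this
    rw [this]
    exact (Finset.sum_coe_sort S (fun k => p k)).symm
  have hM' : M = ∑ k : S, x k * p k := by
    rw [hM]
    have h1 : ∑ k, x k * p k = ∑ k, p k * x k := by
      apply Finset.sum_congr rfl; intro k _; ring
    rw [h1, hvan, hcoe]
    apply Finset.sum_congr rfl; intro k _; ring
  have hg' : ∑ k : S, p k * (T - x k) * g k = 0 := by
    have h1 : ∑ k, p k * (T - x k) * g k = ∑ k, p k * ((T - x k) * g k) := by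
      apply Finset.sum_congr rfl; intro k _; ring
    rw [h1, hvan, hcoe] at hg
    rw [← hg]; apply Finset.sum_congr rfl; intro k _; ring
  have hcore := core_form_nonneg (ι := S) (fun k => p k) (fun k => x k) hp' hx' T M hT' hM'
    (fun k => V k) (fun k => hV k) (fun k => g k) hg'
  -- translate back
  have e1 : ∑ k, p k * V k * g k ^ 2 = ∑ k : S, p k * V k * g k ^ 2 := by
    have h1 : ∑ k, p k * V k * g k ^ 2 = ∑ k, p k * (V k * g k ^ 2) := by
      apply Finset.sum_congr rfl; intro k _; ring
    rw [h1, hvan, hcoe]; apply Finset.sum_congr rfl; intro k _; ring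
  have e2 : ∑ k, p k * g k = ∑ k : S, p k * g k := by rw [hvan, hcoe]
  rw [e1, e2]
  exact hcore

end Summit.HodgeConjecture.HodgeConjecture.WeilClassTestChargeZeroHyperplane
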